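import Mathlib.LinearAlgebra.Matrix.Determinant.Basic
import Mathlib.LinearAlgebra.Matrix.Notation
import Mathlib.GroupTheory.Subgroup.Center
import Mathlib.Algebra.Group.Subgroup.Basic
import Mathlib.NumberTheory.Real.Irrational
import Mathlib.Tactic.NormNum.Irrational
import Mathlib.Tactic.NormNum
import Mathlib.Tactic.NormNum.Prime
import Mathlib.Tactic.Ring
import Mathlib.Tactic.Linarith
import Mathlib.Tactic.LinearCombination
import HarnessLib

set_option linter.dupNamespace false

/-!
# Weil-type family coverage — TYPE-III WINDOWS, part R (census block b04.27): the arithmetic and algebra behind THEOREM S29 (the cusp-CM census of the 568 four-point sixfold families, the product law, the r-law, the symmetry mechanisms)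

research route conditional on HC_CM; not a corollary; Q11.4-sentence-2 already refuted in dim ≥ 3.

Ring 2, WEIL-TYPE FAMILY-COVERAGE CENSUS (`HOME/WEIL-FAMILY-COVERAGE.md` `## b04`, block b04.27, owner ring2-b04, gen 63).  SETTING (informal,
NOT formalised): the hidden sixfold `B_t` (`D`-rank 3) of a four-point `G`-curve family degenerates at a cusp with `r = 0` to `B_cusp` with
`B_cusp² ∼ e_χ[Ind Jac C_A] × e_χ[Ind Jac C_B]`; the PRODUCT LAW says that at a CM point `B ∼ ∏ A_i^{2m_i}` of `T_D(Δ,S)_k` one has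
`Δ ≡ ∏ |d_{L_i}|^{m_i}` mod squares; its proof uses the transfer identity `Nrd_{M_2(D)}(ρ(a)) = N_{F/ℚ}(Nrd_{D_F}(a))` for `a = a₀ + a₁√Δ′ ∈ D ⊗ F`
and, when the CM field does not split `D`, the Dieudonné computation `Nrd [[a,−b],[b,δa]] = (b² − δ·Nrd a)²`.  THIS FILE checks, with no `sorry`
and no new definition: (1) both quaternionic identities in the SPLIT MODEL of `(α,β)_ℚ` (`α = s²`, a quaternion `w + xi + yj + zk ↦
[[w + xs, y + zs],[β(y − zs), w − xs]]`, `Nrd = det`, `Nrd` on `M_2(D)` = the `4 × 4` determinant): `nrd_split`, `transfer_rank_one`,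
`division_block_square`; (2) the group-theoretic exclusion of `G × C₂` among the symmetry groups of a three-point datum: a central element and one
more element cannot generate a non-abelian group (`comm_of_central_pair_generates`); (3) the r-LAW as linear arithmetic (`r_law`), the `2 + 4`
splitting at `k = 3`, `f = 4` (`k3_f4_sides`), the parity obstruction to Frobenius-type symmetry at odd `k` (`frobenius_type_even_k`), the odd-rank
unitary discriminant (`cube_mod_squares`); (4) the square-class identities in `ℚ(√5)` / `ℚ(√2)` that merge the readers' labels into six simple
CM surfaces (`canonical_surface_fields`) and the non-square facts that keep them apart (`not_square_in_Q_sqrt5`, `three_not_square_in_Q_sqrt2`);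
(5) the norms of the new icosian / octahedral values and the product-law bookkeeping of the CM sixfold types (`norm_new_values`,
`product_law_types`, `disc_zeta5`); (6) Riemann–Hurwitz / Chevalley–Weil bookkeeping of the new cusp curves (`rh_new_sides`), the Dixon primes
(`dixon_primes`) and the census totals (`census_totals`).  Nothing about abelian varieties, Shimura varieties or covers is formalised; `HC_CM`
is used nowhere.
-/

namespace Summit.HodgeConjecture.HodgeConjecture.Ring2.WeilCoverage.SixfoldCuspCM

open Matrix

/-! ## (1) Reduced norms in the split model of a quaternion algebra -/

/-- Split model of `(α,β)` with `α = s²`: the reduced norm of `w + xi + yj + zk` is the determinant `w² − s²x² − βy² + s²βz²`.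
research route conditional on HC_CM; not a corollary; Q11.4-sentence-2 already refuted in dim ≥ 3. -/
theorem nrd_split (β s w x y z : ℚ) :
    Matrix.det !![w + x * s, y + z * s; β * (y - z * s), w - x * s] = w ^ 2 - s ^ 2 * x ^ 2 - β * y ^ 2 + s ^ 2 * β * z ^ 2 := by
  rw [Matrix.det_fin_two_of]
  ring

/-- TRANSFER IDENTITY (LEMMA S29.0 (ii), rank one over a real quadratic centre `F = ℚ(√Δ)`): for PURE quaternions `a₀ = x₁i + x₂j + x₃k`,
`a₁ = y₁i + y₂j + y₃k` of `(s², β)_ℚ`, the reduced norm in `M_2(D)` of `ρ(a₀ + a₁√Δ) = [[a₀, Δa₁],[a₁, a₀]]` (the `4 × 4` determinant in the split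
model) equals `N_{F/ℚ}(Nrd(a₀ + a₁√Δ)) = (Nrd a₀ + Δ·Nrd a₁)² − Δ·Trd(a₀ā₁)²`, with `Nrd a₀ = −s²x₁² − βx₂² + s²βx₃²` and
`Trd(a₀ā₁) = 2(s²x₁y₁ + βx₂y₂ − s²βx₃y₃)`.  (So `disc_D(Tr_{F/ℚ}⟨a⟩) = det(Tr ω_sω_t)²·N_{F/ℚ}(Nrd a) ≡ N_{F/ℚ}(Nrd a)` mod squares.)
research route conditional on HC_CM; not a corollary; Q11.4-sentence-2 already refuted in dim ≥ 3. -/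
theorem transfer_rank_one (β Δ s x₁ x₂ x₃ y₁ y₂ y₃ : ℚ) :
    Matrix.det !![x₁ * s, x₂ + x₃ * s, Δ * (y₁ * s), Δ * (y₂ + y₃ * s);
                 β * (x₂ - x₃ * s), -(x₁ * s), Δ * (β * (y₂ - y₃ * s)), Δ * (-(y₁ * s));
                 y₁ * s, y₂ + y₃ * s, x₁ * s, x₂ + x₃ * s;
                 β * (y₂ - y₃ * s), -(y₁ * s), β * (x₂ - x₃ * s), -(x₁ * s)]
      = ((-(s ^ 2) * x₁ ^ 2 - β * x₂ ^ 2 + s ^ 2 * β * x₃ ^ 2) + Δ * (-(s ^ 2) * y₁ ^ 2 - β * y₂ ^ 2 + s ^ 2 * β * y₃ ^ 2)) ^ 2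
        - Δ * (2 * (s ^ 2 * x₁ * y₁ + β * x₂ * y₂ - s ^ 2 * β * x₃ * y₃)) ^ 2 := by
  simp only [Matrix.det_succ_row_zero, Fin.sum_univ_succ, Matrix.submatrix_apply]
  simp [Fin.succAbove, Matrix.cons_val', Matrix.cons_val_zero, Matrix.cons_val_succ]
  ring

/-- DIVISION CASE (LEMMA S29.0 (iv)): for a PURE quaternion `a = x₁i + x₂j + x₃k` (`Nrd a = −s²x₁² − βx₂² + s²βx₃²`) and `b, δ ∈ F`, the Gram
matrix `[[a, −b],[b, δa]]` of a `D_F`-rank-2 block `H_1(A⁴)` has reduced norm `(b² − δ·Nrd a)²` — a SQUARE (the `4 × 4` determinant in the split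
model).
research route conditional on HC_CM; not a corollary; Q11.4-sentence-2 already refuted in dim ≥ 3. -/
theorem division_block_square (β δ b s x₁ x₂ x₃ : ℚ) :
    Matrix.det !![x₁ * s, x₂ + x₃ * s, -b, 0;
                 β * (x₂ - x₃ * s), -(x₁ * s), 0, -b;
                 b, 0, δ * (x₁ * s), δ * (x₂ + x₃ * s);
                 0, b, δ * (β * (x₂ - x₃ * s)), δ * (-(x₁ * s))]
      = (b ^ 2 - δ * (-(s ^ 2) * x₁ ^ 2 - β * x₂ ^ 2 + s ^ 2 * β * x₃ ^ 2)) ^ 2 := by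
  simp only [Matrix.det_succ_row_zero, Fin.sum_univ_succ, Matrix.submatrix_apply]
  simp [Fin.succAbove, Matrix.cons_val', Matrix.cons_val_zero, Matrix.cons_val_succ]
  ring

/-! ## (2) The extension `G × C₂` is never the symmetry group of a three-point datum -/

/-- THEOREM S29.1 (b): if a CENTRAL element `s` and one further element `y` generate the whole group, the group is commutative — so a
three-point `Σ`-datum `(s₀, y, u)` with `s₀` a central coset involution cannot generate a non-abelian `Σ = G × C₂`.
research route conditional on HC_CM; not a corollary; Q11.4-sentence-2 already refuted in dim ≥ 3. -/
theorem comm_of_central_pair_generates {G : Type*} [Group G] (s y : G) (hs : s ∈ Subgroup.center G)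
    (htop : Subgroup.closure ({s, y} : Set G) = ⊤) (a b : G) : a * b = b * a := by
  have hcomm : ∀ x ∈ ({s, y} : Set G), ∀ z ∈ ({s, y} : Set G), x * z = z * x := by
    intro x hx z hz
    simp only [Set.mem_insert_iff, Set.mem_singleton_iff] at hx hz
    rcases hx with rfl | rfl <;> rcases hz with rfl | rfl
    · rfl
    · exact ((Subgroup.mem_center_iff.mp hs) z).symm
    · exact (Subgroup.mem_center_iff.mp hs) x
    · rfl
  haveI := Subgroup.isMulCommutative_closure hcomm
  have ha : a ∈ Subgroup.closure ({s, y} : Set G) := by rw [htop]; exact Subgroup.mem_top a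
  have hb : b ∈ Subgroup.closure ({s, y} : Set G) := by rw [htop]; exact Subgroup.mem_top b
  exact setLike_mul_comm ha hb

/-! ## (3) The r-law and its corollaries (linear arithmetic of Chevalley–Weil multiplicities) -/

/-- THEOREM S29.3 (a): with `m_H = 2(Σ_{side} w − f + a₀(H))` on both sides, `Σ_{j≤4} w(c_j) = f + k`, the pinched class counted on both sides,
and `2r = 2k − m_A − m_B`: `r = f − 2w(c) − a₀(A) − a₀(B)`.
research route conditional on HC_CM; not a corollary; Q11.4-sentence-2 already refuted in dim ≥ 3. -/
theorem r_law (f k w₁ w₂ w₃ w₄ wc a₀A a₀B mA mB r : ℤ) (hsum : w₁ + w₂ + w₃ + w₄ = f + k)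
    (hA : mA = 2 * (w₁ + w₂ + wc - f + a₀A)) (hB : mB = 2 * (w₃ + w₄ + wc - f + a₀B)) (hr : 2 * r = 2 * k - mA - mB) :
    r = f - 2 * wc - a₀A - a₀B := by
  omega

/-- THEOREM S29.3 (b) (`k = 3`, `f = 4`, weights `(2,2,2,1)`, `a₀ = 0`): `r = 4 − 2w(c) ∈ {0, 2}` for `w(c) ∈ {1, 2}`; at `w(c) = 2` the side
containing the weight-1 class has `m = 2(1 + 2 + 2 − 4) = 2` and the other `m = 2(2 + 2 + 2 − 4) = 4` (the `2 + 4` splitting); at `w(c) = 1`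
the multiplicities are `2` and `0`; `w(c) = 0` would give `r = 4 > k`.
research route conditional on HC_CM; not a corollary; Q11.4-sentence-2 already refuted in dim ≥ 3. -/
theorem k3_f4_sides :
    (4 : ℤ) - 2 * 2 = 0 ∧ (4 : ℤ) - 2 * 1 = 2 ∧ 2 * ((1 : ℤ) + 2 + 2 - 4) = 2 ∧ 2 * ((2 : ℤ) + 2 + 2 - 4) = 4 ∧
    2 * ((1 : ℤ) + 2 + 1 - 4) = 0 ∧ 2 * ((2 : ℤ) + 2 + 1 - 4) = 2 ∧ (2 : ℤ) + 4 = 2 * 3 ∧ ¬ ((4 : ℤ) - 2 * 0 ≤ 3) := by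
  omega

/-- THEOREM S29.1 (c) (parity): if `H¹_χ` (multiplicity `2k`) restricts from `a·χ̃ + b·χ̃^σ` with `a = b` (Galois) and `a` even (Schur index 2),
then `k` is even — no Frobenius-type symmetric datum exists at odd `k`.
research route conditional on HC_CM; not a corollary; Q11.4-sentence-2 already refuted in dim ≥ 3. -/
theorem frobenius_type_even_k (a b k : ℕ) (hab : a = b) (ha : 2 ∣ a) (hsum : a + b = 2 * k) : 2 ∣ k := by
  omega

/-- THEOREM S29.1 (g) (odd rank): the trace form of a rank-`3` hermitian space over `ℚ(√−m)` has discriminant `≡ m³ ≡ m` mod squares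
(`m³ = m·m²`), so the unitary field of an inner/diagonal-symmetric `k = 3` datum is the discriminant field `ℚ(√−Δ)` itself; instances
`4·4·4 = 1·8²` (`(10,10,10)_{χ₆}`, `M = ℚ(i)`) and `8·4·4 = 2·8²` (`(4,10,10′)_{χ₆}`, `M = ℚ(√−2)`).
research route conditional on HC_CM; not a corollary; Q11.4-sentence-2 already refuted in dim ≥ 3. -/
theorem cube_mod_squares (m : ℤ) : m ^ 3 = m * m ^ 2 ∧ (4 : ℤ) * 4 * 4 = 1 * 8 ^ 2 ∧ (8 : ℤ) * 4 * 4 = 2 * 8 ^ 2 := by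
  refine ⟨by ring, by norm_num, by norm_num⟩

/-! ## (4) The six simple CM surfaces: square classes in `ℚ(√5)` and `ℚ(√2)` -/

/-- VERIFY-S29 §4b: with `s² = 5` (golden ratio `φ = (1+s)/2`): `(5+s)/2 · φ² = 5 + 2s` and `4·(5+s)/2 = 10 + 2s` (so the readings
`θ = 5 ± 2√5`, `10 ± 2√5` name `ℚ(√5)(√−(5+√5)/2) = ℚ(ζ₅)`), `(5+s)·φ² = 10 + 4s` (`θ = 5 ± √5 ~ 10 ± 4√5`); with `t² = 2`: `(2+t)·t² = 4 + 2t`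
and `(4+2t)·t² = 8 + 4t` (`θ = 4 ± 2√2 ~ 8 ± 4√2 ~ 2 + √2`).
research route conditional on HC_CM; not a corollary; Q11.4-sentence-2 already refuted in dim ≥ 3. -/
theorem canonical_surface_fields (s t : ℝ) (hs : s ^ 2 = 5) (ht : t ^ 2 = 2) :
    (5 + s) / 2 * ((1 + s) / 2) ^ 2 = 5 + 2 * s ∧ 4 * ((5 + s) / 2) = 10 + 2 * s ∧ (5 + s) * ((1 + s) / 2) ^ 2 = 10 + 4 * s ∧
    (2 + t) * t ^ 2 = 4 + 2 * t ∧ (4 + 2 * t) * t ^ 2 = 8 + 4 * t := by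
  have h3 : s ^ 3 = 5 * s := by
    calc s ^ 3 = s ^ 2 * s := by ring
      _ = 5 * s := by rw [hs]
  refine ⟨?_, by ring, ?_, ?_, ?_⟩
  · linear_combination (1 / 8 : ℝ) * h3 + (7 / 8 : ℝ) * hs
  · linear_combination (1 / 4 : ℝ) * h3 + (7 / 4 : ℝ) * hs
  · linear_combination (2 + t) * ht
  · linear_combination (4 + 2 * t) * ht

/-- VERIFY-S29 §4b: `2`, `3`, `6` are NOT squares in `ℚ(√5)`: `(a + b√5)² = c` with `c ∈ {2,3,6}` forces `2ab = 0` and then `a² = c` or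
`(5b)² = 5c`, i.e. a rational square root of `2, 3, 6, 10, 15` or `30` — so the four icosian surface fields `ℚ(√5)(√−θ)`,
`θ ∈ {(5+√5)/2, 5+√5, 3(5+√5)/2, 3(5+√5)}` (pairwise ratios `2, 3, 6, 3/2 ≡ 6`), are pairwise distinct.
research route conditional on HC_CM; not a corollary; Q11.4-sentence-2 already refuted in dim ≥ 3. -/
theorem not_square_in_Q_sqrt5 (a b : ℚ) (hab : 2 * a * b = 0) :
    a ^ 2 + 5 * b ^ 2 ≠ 2 ∧ a ^ 2 + 5 * b ^ 2 ≠ 3 ∧ a ^ 2 + 5 * b ^ 2 ≠ 6 := by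
  have key : ∀ (q : ℚ) (n : ℕ), Irrational (Real.sqrt n) → q ^ 2 ≠ n := by
    intro q n hn hq
    have h2 : ((q : ℝ)) ^ 2 = n := by exact_mod_cast hq
    have h3 : Real.sqrt n = |(q : ℝ)| := by rw [← h2, Real.sqrt_sq_eq_abs]
    exact hn.ne_rat |q| (by rw [h3, Rat.cast_abs])
  have i2 : Irrational (Real.sqrt (2 : ℕ)) := by norm_num
  have i3 : Irrational (Real.sqrt (3 : ℕ)) := by norm_num
  have i6 : Irrational (Real.sqrt (6 : ℕ)) := by norm_num
  have i10 : Irrational (Real.sqrt (10 : ℕ)) := by norm_num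
  have i15 : Irrational (Real.sqrt (15 : ℕ)) := by norm_num
  have i30 : Irrational (Real.sqrt (30 : ℕ)) := by norm_num
  rcases mul_eq_zero.mp hab with h | h
  · rcases mul_eq_zero.mp h with h2 | ha
    · norm_num at h2
    · subst ha
      refine ⟨?_, ?_, ?_⟩ <;> intro hc
      · exact key (5 * b) 10 i10 (by push_cast; nlinarith [hc])
      · exact key (5 * b) 15 i15 (by push_cast; nlinarith [hc])
      · exact key (5 * b) 30 i30 (by push_cast; nlinarith [hc])
  · subst h
    refine ⟨?_, ?_, ?_⟩ <;> intro hc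
    · exact key a 2 i2 (by push_cast; nlinarith [hc])
    · exact key a 3 i3 (by push_cast; nlinarith [hc])
    · exact key a 6 i6 (by push_cast; nlinarith [hc])

/-- VERIFY-S29 §4b: `3` is not a square in `ℚ(√2)` (`a² = 3` or `(2b)² = 6` would be a rational square root of `3` or `6`), so the two octahedral
surface fields `ℚ(√−(2+√2))` and `ℚ(√2)(√−3(2+√2))` are distinct.
research route conditional on HC_CM; not a corollary; Q11.4-sentence-2 already refuted in dim ≥ 3. -/
theorem three_not_square_in_Q_sqrt2 (a b : ℚ) (hab : 2 * a * b = 0) : a ^ 2 + 2 * b ^ 2 ≠ 3 := by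
  have key : ∀ (q : ℚ) (n : ℕ), Irrational (Real.sqrt n) → q ^ 2 ≠ n := by
    intro q n hn hq
    have h2 : ((q : ℝ)) ^ 2 = n := by exact_mod_cast hq
    have h3 : Real.sqrt n = |(q : ℝ)| := by rw [← h2, Real.sqrt_sq_eq_abs]
    exact hn.ne_rat |q| (by rw [h3, Rat.cast_abs])
  have i3 : Irrational (Real.sqrt (3 : ℕ)) := by norm_num
  have i6 : Irrational (Real.sqrt (6 : ℕ)) := by norm_num
  intro hc
  rcases mul_eq_zero.mp hab with h | h
  · rcases mul_eq_zero.mp h with h2 | ha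
    · norm_num at h2
    · subst ha
      exact key (2 * b) 6 i6 (by push_cast; nlinarith [hc])
  · subst h
    exact key a 3 i3 (by push_cast; nlinarith [hc])

/-! ## (5) Norms and the product-law bookkeeping of the CM sixfold types -/

/-- The values met first at `k = 3`: `N(10 ± 2√5) = 80 = 5·4²` (the `Dic₅ (4,4,5)` sides), `N(8 ± 4√2) = 32 = 2·4²` (the `Q₁₆ (8,4,4)` sides);
and `|d_{ℚ(ζ₅)}| = 5³ = 5·5²` (the `C₅`/`C_{10}` Fermat pieces).  All `≡ 5` resp. `2` mod squares, as the product law requires of a simple surface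
factor on these classes.
research route conditional on HC_CM; not a corollary; Q11.4-sentence-2 already refuted in dim ≥ 3. -/
theorem norm_new_values : (10 : ℤ) ^ 2 - 5 * 2 ^ 2 = 5 * 4 ^ 2 ∧ (8 : ℤ) ^ 2 - 2 * 4 ^ 2 = 2 * 4 ^ 2 ∧ (5 : ℤ) ^ 3 = 5 * 5 ^ 2 := by
  norm_num

/-- LEMMA S29.0 on the CM sixfold types of the census (`E_d` contributes `d`, `E_d⁴` a square, a simple surface `S(L)` contributes `|d_L| ≡ 5`
(icosian, `ℚ(ζ₅)`) or `2` (octahedral)); each product is `Δ·c²` for the class it was found on: `E_{15}²×E_5⁴` on `Δ = 15`, `E_2²×E_3²×E_6²` on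
`Δ = 1`, `E_3²×E_5²×E_6²` on `10`, `E_{10}²×E_3²×E_6²` on `5`, `E_1²×E_3²×E_6²` on `2`, `E_3²×S(ico)²` on `15`, `E_{15}²×S(ico)²` on `3`,
`E_6²×S(ico)²` on `30`, `E_{30}²×S(ico)²` on `6`, `E_{30}²×S(oct)²` on `15`, `E_{15}²×S(oct)²` on `30`, `E_6²×S(oct)²` on `3`, `E_3²×S(oct)²` on `6`,
`E_5²×S(ℚ(ζ₅))²` on `1`, `E_2²×S(ℚ(ζ₅))²` on `10`, `E_{10}²×S(ℚ(ζ₅))²` on `2`, `E_1²×S(ℚ(ζ₅))²` on `5`, and the sixth powers `E_{15}⁶`, `E_3⁶`,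
`E_6⁶` on `15`, `3`, `6`.
research route conditional on HC_CM; not a corollary; Q11.4-sentence-2 already refuted in dim ≥ 3. -/
theorem product_law_types :
    (15 : ℕ) * 5 ^ 2 = 15 * 5 ^ 2 ∧ (2 : ℕ) * 3 * 6 = 1 * 6 ^ 2 ∧ (3 : ℕ) * 5 * 6 = 10 * 3 ^ 2 ∧ (10 : ℕ) * 3 * 6 = 5 * 6 ^ 2 ∧
    (1 : ℕ) * 3 * 6 = 2 * 3 ^ 2 ∧ (3 : ℕ) * 5 = 15 ∧ (15 : ℕ) * 5 = 3 * 5 ^ 2 ∧ (6 : ℕ) * 5 = 30 ∧ (30 : ℕ) * 5 = 6 * 5 ^ 2 ∧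
    (30 : ℕ) * 2 = 15 * 2 ^ 2 ∧ (15 : ℕ) * 2 = 30 ∧ (6 : ℕ) * 2 = 3 * 2 ^ 2 ∧ (3 : ℕ) * 2 = 6 ∧ (5 : ℕ) * 5 = 1 * 5 ^ 2 ∧
    (2 : ℕ) * 5 = 10 ∧ (10 : ℕ) * 5 = 2 * 5 ^ 2 ∧ (1 : ℕ) * 5 = 5 ∧ (15 : ℕ) ^ 3 = 15 * 15 ^ 2 ∧ (3 : ℕ) ^ 3 = 3 * 3 ^ 2 ∧
    (6 : ℕ) ^ 3 = 6 * 6 ^ 2 := by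
  norm_num

/-- `|d_L|` mod squares for an abelian CM field = product of the discriminants of its quadratic subfields: `ℚ(ζ₅)` has the single quadratic
subfield `ℚ(√5)` and `|d| = 125 = 5·5²`; `ℚ(ζ₈)` (subfields of discriminants `−4, 8, −8`) has `|d| = 256 = 4·8·8`; `ℚ(ζ₁₅)` (`5, −3, −15`) has
`|d| = 3⁴·5⁶ = 1265625` and `5·3·15 = 15²`.
research route conditional on HC_CM; not a corollary; Q11.4-sentence-2 already refuted in dim ≥ 3. -/
theorem disc_zeta5 : (125 : ℕ) = 5 * 5 ^ 2 ∧ (256 : ℕ) = 4 * 8 * 8 ∧ (3 : ℕ) ^ 4 * 5 ^ 6 = 1265625 ∧ (5 : ℕ) * 3 * 15 = 15 ^ 2 := by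
  norm_num

/-! ## (6) Riemann–Hurwitz / Chevalley–Weil bookkeeping, Dixon primes, census totals -/

/-- Genera of the rigid cusp curves first met at `k = 3` (`2g − 2 = −2|H| + Σ_j (|H| − |H|/m_j)`): `Q₈ (4,4,4)` g 2 (Bolza); `Q₁₆ (8,4,4)` g 4;
`C₈ (8,8,4)` g 3; `C_{10} (10,2,5)` g 2; `Dic₅ (4,4,5)` g 4 and `(4,4,10)` g 5; `Dic₃ (4,4,6)` g 3; `SL₂(3) (6,6,6)` g 7; `C₃×C₆ (3,6,6)` g 4;
`SL₂(9) (5,5,6)` g 157 and `(10,10,6)` g 229 (the two Frobenius-symmetric data); and the `k = 3` side multiplicities `m = 2(Σw − f + a₀)`: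
`(2,2,2) ↦ 4`, `(1,2,2) ↦ 2` (`f = 4`), `(3,3,3) ↦ 6` never at a cusp.
research route conditional on HC_CM; not a corollary; Q11.4-sentence-2 already refuted in dim ≥ 3. -/
theorem rh_new_sides :
    2 * 2 - 2 = -2 * 8 + (8 - 2) + (8 - 2) + (8 - 2) ∧ 2 * 4 - 2 = -2 * 16 + (16 - 2) + (16 - 4) + (16 - 4) ∧
    2 * 3 - 2 = -2 * 8 + (8 - 1) + (8 - 1) + (8 - 2) ∧ 2 * 2 - 2 = -2 * 10 + (10 - 1) + (10 - 5) + (10 - 2) ∧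
    2 * 4 - 2 = -2 * 20 + (20 - 5) + (20 - 5) + (20 - 4) ∧ 2 * 5 - 2 = -2 * 20 + (20 - 5) + (20 - 5) + (20 - 2) ∧
    2 * 3 - 2 = -2 * 12 + (12 - 3) + (12 - 3) + (12 - 2) ∧ 2 * 7 - 2 = -2 * 24 + (24 - 4) + (24 - 4) + (24 - 4) ∧
    2 * 4 - 2 = -2 * 18 + (18 - 6) + (18 - 3) + (18 - 3) ∧ 2 * 157 - 2 = -2 * 720 + (720 - 144) + (720 - 144) + (720 - 120) ∧
    (2 : ℤ) * 229 - 2 = -2 * 720 + (720 - 72) + (720 - 72) + (720 - 120) ∧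
    2 * ((2 : ℤ) + 2 + 2 - 4 + 0) = 4 ∧ 2 * ((1 : ℤ) + 2 + 2 - 4 + 0) = 2 ∧ 2 * ((3 : ℤ) + 3 + 3 - 6 + 0) = 6 := by
  norm_num

/-- The Dixon primes of the exact character tables: `p = 61` for `2I` and `2I∘C₄` (`exp = 60`, `61 ≡ 1 (60)`, `(61−1)² > 4·240 ≥ 4·120`) and
`p = 241` for `SL₂(9)`, its extensions of order 1440, and `2I.2_δ` (`exp = 120`, `241 ≡ 1 (120)`, `240² > 4·1440`); both prime
and coprime to the group orders.
research route conditional on HC_CM; not a corollary; Q11.4-sentence-2 already refuted in dim ≥ 3. -/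
theorem dixon_primes :
    Nat.Prime 61 ∧ 61 % 60 = 1 ∧ (61 - 1) ^ 2 > 4 * 240 ∧ Nat.Prime 241 ∧ 241 % 120 = 1 ∧ (241 - 1) ^ 2 > 4 * 1440 ∧
    Nat.Coprime 61 240 ∧ Nat.Coprime 241 1440 := by
  refine ⟨by norm_num, by norm_num, by norm_num, by norm_num, by norm_num, by norm_num, by decide, by decide⟩

/-- Census totals of THEOREM S29.2: `568 = 63 + 39 + 233 + 233` orbits; `1 489 664 = 41 184 + 12 704 + 717 888 + 717 888` cusps
`= 1 409 760 (r = 0) + 79 904 (r = 2)`; `1 409 760 = 330 560 (both sides CM) + 1 079 200 (one side CM) + 0`; `560 = 568 − 8` families with a CM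
cusp; `k = 2` re-run: `140 = 23 + 13 + 52 + 52`, `122 240` cusps, `117 784 = 88 808 + 28 976`; and the four one-side counts.
research route conditional on HC_CM; not a corollary; Q11.4-sentence-2 already refuted in dim ≥ 3. -/
theorem census_totals :
    63 + 39 + 233 + 233 = 568 ∧ 41184 + 12704 + 717888 + 717888 = 1489664 ∧ 1409760 + 79904 = 1489664 ∧
    330560 + 1079200 + 0 = 1409760 ∧ 568 - 8 = 560 ∧ 23 + 13 + 52 + 52 = 140 ∧ 12048 + 2288 + 53952 + 53952 = 122240 ∧
    88808 + 28976 = 117784 ∧ 10528 + 4000 + 158016 + 158016 = 330560 ∧ 23456 + 5632 + 525056 + 525056 = 1079200 := by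
  norm_num

end Summit.HodgeConjecture.HodgeConjecture.Ring2.WeilCoverage.SixfoldCuspCM
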